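import Summits.PneNP.PneNP.Theorems.PhaseTwinsPolyDepthTwinsAboveTseitinGap

/-!
# Crux `PolyDepthTwinsAbove` (stmt-PneNP-2719), line `parity-wired-ports`: `stub_tseitinGap` is false without `NoFixed`

Negative lemma (refuter, drefute seat; load-bearing analysis of the landed stub `stub_tseitinGap`, which assumes
`NoFixed R`).  If the base rotation map has a HALF-EDGE at `w₀` — a dart `(w₀, i₀)` fixed by `rot` — then the odd
charge `1_{w₀}` is a gauge artefact: swapping the phases of the two copies `g_{(w₀,i₀),0}`, `g_{(w₀,i₀),1}` of that
dart is a weight-preserving bijection between phase vectors under charge `1_{w₀}` and under charge `0` (a fixed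
dart is never canonical, so no pair factor reads it; only the complex at `w₀` reads it, on the leg `i₀`, and
there the Tseitin covariance `tg_cxW_shift` turns the swap into the charge change `1 ↦ 0`) — this is
`pwW_single_swap_of_fixed`, an exact identity for every `λ, q±, κ₁, κ₂`.  Hence
`max_Y pwW (1_{w₀}) Y = max_Y pwW 0 Y` and the conclusion of `stub_tseitinGap` (a strict boost `e^{κ₂ g} > 1` of the
odd charge below the even one) fails for EVERY coupling `κ₁` — unlike `tseitinGap_false_without_coupling`
(`κ₁ = 0`).  The line itself is untouched (`CFIMatching.noFixed_base3`); the lemma records that any proof of the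
stub must use `NoFixed`, and that parity-wired designs over bases WITH half-edges carry no odd class at the
half-edge's vertex.  Brute-force cross-check (refuter folder `compute/tg_nofixed.py`, `M = 2`, two edges and two
half-edges, all `2^12` phase vectors, four parameter sets): ratio of the two maxima `= e^{κ₂ g}` exactly. [folklore]
-/

noncomputable section

open scoped Classical BigOperators

namespace Summit.PneNP.PneNP.Theorems.PolyDepthTwinsAbove.Negative

open Finset
open Summit.PneNP.PneNP.Cruxes.PolyDepthTwinsAbove.ParityWiredPorts
open Literature.Computability.Complexity.Expander (RotGraph)
open Literature.ModelTheory.FiniteModelTheory.TseitinColouring (Dart)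
open Literature.ModelTheory.FiniteModelTheory.CFIMatching (Canon zmod2_add_self)

set_option linter.dupNamespace false

variable {M : ℕ}

/-- A dart fixed by `rot` is not canonical, so its edge-end plugs into side `1` of its own copy pair. -/
theorem canonEnd_of_fixed (R : RotGraph M 3) {δ₀ : Dart M 3} (hfix : R.rot δ₀ = δ₀) :
    canonEnd R δ₀ = (δ₀, 1) := by
  unfold canonEnd
  rw [if_neg, hfix]
  unfold Canon
  rw [hfix]
  exact lt_irrefl _

/-- No other dart plugs into the copies of a fixed dart. -/
theorem canonEnd_fst_ne_of_fixed (R : RotGraph M 3) {δ₀ : Dart M 3} (hfix : R.rot δ₀ = δ₀) {δ : Dart M 3}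
    (hne : δ ≠ δ₀) : (canonEnd R δ).1 ≠ δ₀ := by
  unfold canonEnd
  split_ifs
  · exact hne
  · intro h
    apply hne
    have := congrArg R.rot h
    rwa [R.rot_rot, hfix] at this

/-- **The half-edge gauge.** If the dart `(w₀, i₀)` is fixed by `rot`, then exchanging the phases of its two
copies turns the weight under the odd charge `1_{w₀}` into the weight under charge `0`, for EVERY phase vector,
every coupling `κ₁` and every `κ₂` (no pair factor reads a fixed dart; only the complex at `w₀` reads it, on leg
`i₀`, where the swap is the bit shift by the indicator of `i₀`, i.e. the charge change `1 ↦ 0` by `tg_cxW_shift`). -/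
theorem pwW_single_swap_of_fixed (R : RotGraph M 3) (w₀ : Fin M) (i₀ : Fin 3)
    (hfix : R.rot (w₀, i₀) = (w₀, i₀)) (lam qp qm : ℝ) (κ₁ κ₂ : ℕ) (Y₀ : Dart M 3 × ZMod 2 → Bool) :
    pwW R lam qp qm κ₁ κ₂ (Pi.single w₀ 1)
        (fun g => if g.1 = (w₀, i₀) then Y₀ (g.1, g.2 + 1) else Y₀ g) =
      pwW R lam qp qm κ₁ κ₂ 0 Y₀ := by
  set Y : Dart M 3 × ZMod 2 → Bool := fun g => if g.1 = (w₀, i₀) then Y₀ (g.1, g.2 + 1) else Y₀ g with hY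
  have hc0 := canonEnd_of_fixed R hfix
  have hne : ∀ δ : Dart M 3, δ ≠ (w₀, i₀) → (canonEnd R δ).1 ≠ (w₀, i₀) :=
    fun δ hδ => canonEnd_fst_ne_of_fixed R hfix hδ
  unfold pwW
  congr 1
  · -- pair factors: a canonical dart is not the fixed one
    refine prod_congr rfl fun δ _ => ?_
    by_cases hC : Canon R δ
    · have hδ : δ ≠ (w₀, i₀) := by
        rintro rfl
        unfold Canon at hC
        rw [hfix] at hC
        exact lt_irrefl _ hC
      simp only [if_pos hC, hY, if_neg hδ]
    · simp only [if_neg hC]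
  · -- complex factors
    refine prod_congr rfl fun w _ => ?_
    congr 1
    by_cases hw : w = w₀
    · subst hw
      -- at `w₀`: the pattern is the old one read through the shift by the indicator of `i₀`
      have hpat : (fun p : Fin 3 × ZMod 2 => Y ((canonEnd R (w, p.1)).1, p.2)) =
          fun p : Fin 3 × ZMod 2 => (fun p' : Fin 3 × ZMod 2 => Y₀ ((canonEnd R (w, p'.1)).1, p'.2))
            (p.1, p.2 + (fun k : Fin 3 => if k = i₀ then (1 : ZMod 2) else 0) p.1) := by
        funext p
        rcases p with ⟨i, a⟩
        by_cases hi : i = i₀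
        · subst hi
          simp only [hc0, hY, if_true]
        · have h1 : (canonEnd R (w, i)).1 ≠ (w, i₀) := hne (w, i) (fun h => hi (Prod.mk.inj h).2)
          simp only [hY, if_neg h1, if_neg hi, add_zero]
      have hsum : (∑ k : Fin 3, (if k = i₀ then (1 : ZMod 2) else 0)) = 1 := by simp
      have hshift := tg_cxW_shift lam qp qm 1 (fun k : Fin 3 => if k = i₀ then (1 : ZMod 2) else 0)
        (fun p' : Fin 3 × ZMod 2 => Y₀ ((canonEnd R (w, p'.1)).1, p'.2))
      rw [hpat, show (Pi.single w (1 : ZMod 2) : Fin M → ZMod 2) w = 1 from Pi.single_eq_same w 1,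
        show (0 : Fin M → ZMod 2) w = 0 from rfl, hshift, hsum, zmod2_add_self]
    · -- elsewhere: the pattern does not read the fixed dart and the charge is `0` on both sides
      have hpat : (fun p : Fin 3 × ZMod 2 => Y ((canonEnd R (w, p.1)).1, p.2)) =
          fun p : Fin 3 × ZMod 2 => Y₀ ((canonEnd R (w, p.1)).1, p.2) := by
        funext p
        have h1 : (canonEnd R (w, p.1)).1 ≠ (w₀, i₀) := hne (w, p.1) (fun h => hw (Prod.mk.inj h).1)
        simp only [hY, if_neg h1]
      rw [hpat]
      simp [hw]

/-- **`stub_tseitinGap` is false without `NoFixed`** (any proof must use it): with a half-edge `(w₀, i₀)`,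
for all `0 ≤ λ`, `0 < q⁻ < q⁺ < 1`, strict charge visibility `Ψ(1) < Ψ(0)`, every `κ₁` and every `κ₂ ≥ 1`,
no `Y₀` under charge `0` dominates all phase vectors under the odd charge `1_{w₀}` boosted by `e^{κ₂ g}`. -/
theorem tseitinGap_false_without_noFixed (R : RotGraph M 3) (w₀ : Fin M) (i₀ : Fin 3)
    (hfix : R.rot (w₀, i₀) = (w₀, i₀)) {lam qp qm : ℝ} (hlam : 0 ≤ lam) (hqm : 0 < qm) (hlt : qm < qp)
    (hqp : qp < 1) (hΨ : pwPsi lam qp qm 1 < pwPsi lam qp qm 0) (κ₁ : ℕ) {κ₂ : ℕ} (hκ₂ : 1 ≤ κ₂) :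
    ¬ ∃ Y₀ : Dart M 3 × ZMod 2 → Bool, ∀ Y : Dart M 3 × ZMod 2 → Bool,
      pwW R lam qp qm κ₁ κ₂ (Pi.single w₀ 1) Y *
          Real.exp (κ₂ * (pwPsi lam qp qm 0 - pwPsi lam qp qm 1)) ≤
        pwW R lam qp qm κ₁ κ₂ 0 Y₀ := by
  rintro ⟨Y₀, h⟩
  have hqp1 : qp ≤ 1 := hqp.le
  have hqm1 : qm ≤ 1 := (hlt.trans hqp).le
  -- the swap turns charge `1_{w₀}` into charge `0`
  have key := pwW_single_swap_of_fixed R w₀ i₀ hfix lam qp qm κ₁ κ₂ Y₀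
  -- positivity of the reference side and strictness of the boost
  have hP : 0 < pwW R lam qp qm κ₁ κ₂ 0 Y₀ := by
    unfold pwW
    refine mul_pos (prod_pos fun δ _ => ?_) (prod_pos fun w _ => pow_pos (tg_cxW_pos hlam hqp1 hqm1 _ _) _)
    split_ifs
    · exact (tg_pairW_facts hqm hlt hqp κ₁ _ _).1
    · exact one_pos
  have hexp : 1 < Real.exp (κ₂ * (pwPsi lam qp qm 0 - pwPsi lam qp qm 1)) := by
    have hk : (0 : ℝ) < κ₂ := Nat.cast_pos.2 hκ₂
    have := Real.exp_lt_exp.2 (mul_pos hk (sub_pos.2 hΨ))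
    rwa [Real.exp_zero] at this
  have hmain := h (fun g => if g.1 = (w₀, i₀) then Y₀ (g.1, g.2 + 1) else Y₀ g)
  rw [key] at hmain
  have hlt' : pwW R lam qp qm κ₁ κ₂ 0 Y₀ * 1 <
      pwW R lam qp qm κ₁ κ₂ 0 Y₀ * Real.exp (κ₂ * (pwPsi lam qp qm 0 - pwPsi lam qp qm 1)) :=
    mul_lt_mul_of_pos_left hexp hP
  linarith

end Summit.PneNP.PneNP.Theorems.PolyDepthTwinsAbove.Negative
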